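import Summits.CriticalPhenomena.SAWScalingLimit.Theorems.SAWDevelopingMapHexTightReversalDefs
import Summits.CriticalPhenomena.SAWScalingLimit.Theorems.ObservableToSLE.Negative.Identification
import Summits.CriticalPhenomena.SAWScalingLimit.Theorems.DefectDecoherence.Negative.WallExitTwoPoint
import Literature.Probability.RandomPlanarGeometry.HexSAWVirginizationChordal
import Literature.Probability.RandomPlanarGeometry.HexSAWVirginizationRooted
import Literature.Probability.RandomPlanarGeometry.ShellSubdivision
import HarnessLib

/-!
# Stub `stub_virginization` of the line `reversal-virgin-disc` (crux `HexTight`, stmt-CriticalPhenomena-5423)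

Landing target `Summits/CriticalPhenomena/SAWScalingLimit/Theorems/SAWDevelopingMapHexTightVirginization.lean`;
objects (`IsHArc`, `arcCurve`, `arcMass`, `travMass`, `Straddles`, `IsVirgin`) from
`SAWDevelopingMapHexTightReversalDefs.lean`. WHAT: the chordal (`ArcShellBound`) and radial
(`RootedShellBound`) arc shell bounds on a virgin lattice disc — the two hypotheses of the stub,
taken at exponent `7` — imply Aizenman–Burchard's hypothesis (H1) with exponent `7/3 > 2` on every
INTERIOR shell `D(x; ρ, R) ⊆ D` for the critical hexagonal SAW law `hexSAWLaw`, for every Dobrushin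
domain and endpoint approximation. HOW (exact identities + bookkeeping, no estimate is assumed):
cube-root trick (`exists_subshell`, `subshell_parameters` of `ShellSubdivision.lean`: a sub-shell of
aspect `(R/ρ)^{1/3}` missing both marked points, which the endpoint limits keep apart); the law is a
normalised finite sum (`embLaw_apply_le_ofReal`, finiteness from
`Theorems/ObservableToSLE/Negative/Identification.lean`); the event is transported to the vertex
sequence (`vertexTraversals_of_hasTraversals_toCurve`) and the two-sided domain Markov reductions
`sum_vertexTraversals_le_chordal` / `sum_vertexTraversals_le_rooted`
(`HexSAWVirginization*.lean`, with reversal of the walks `exists_reverse_event_le` when `a_δ` is the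
deep endpoint) are fed with the arc bounds on the graph `Ω_δ` enlarged inside the disc
(`arcSums_of_arcShellBound`, `arcSums_of_rootedShellBound`, via `isChain_sup_disc_iff`).
-/

noncomputable section

open scoped BigOperators Classical
open MeasureTheory Filter Topology Set Metric
open Literature.Probability.LatticeModels Literature.Probability.RandomPlanarGeometry
  Literature.Probability.RandomPlanarGeometry.SAW
open Summit.CriticalPhenomena.SAWScalingLimit.Theorems.ObservableToSLE.Negative
  (finite_hexDomainSAW finite_embMeshVertices_hex)
open Summit.CriticalPhenomena.SAWScalingLimit.Cruxes.DefectDecoherence.TipMartingaleDepthInduction.WallExitTwoPoint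
  (dist_hexCenter_le_one_of_adj)

namespace Summit.CriticalPhenomena.SAWScalingLimit.Theorems.HexTight.Reversal

/-! ## From the arc bounds with an enlarged graph to the arc sums of `Ω_δ` -/

section ArcSums

variable {Ω : Set ℂ} {δ : ℝ}

/-- The graph `Ω_δ` enlarged by the honeycomb edges of the closed `(N+1)`-disc is virgin for every
vertex set containing the open `N`-disc. -/
theorem isVirgin_sup_disc {z₀ : ℂ} {N : ℝ} {Λ' : Finset HexVertex}
    (hmem : ∀ v : HexVertex, dist (hexCenter v) z₀ < N → v ∈ Λ') :
    IsVirgin (hexDomainGraph Ω δ ⊔ SimpleGraph.fromRel (fun p q => hexGraph.Adj p q ∧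
      dist (hexCenter p) z₀ ≤ N + 1 ∧ dist (hexCenter q) z₀ ≤ N + 1)) Λ' z₀ N :=
  ⟨hmem, fun _ _ hv hv' hvv' => (SimpleGraph.sup_adj _ _ _ _).2
    (Or.inr ((SimpleGraph.fromRel_adj _ _ _).2 ⟨hvv'.ne, Or.inl ⟨hvv', hv, hv'⟩⟩))⟩

/-- The chordal arc bound (hypothesis 1, applied to the graph `Ω_δ` ENLARGED by the honeycomb edges
of the closed `(N+1)`-disc, `isVirgin_sup_disc`) yields the door-to-door arc inequality over arcs
using edges of `Ω_δ` that `sum_vertexTraversals_le_chordal` consumes (`isChain_sup_disc_iff`: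
through a door into `Ω_δ` the two graphs have the same arcs). -/
theorem arcSums_of_arcShellBound (hδ : 0 < δ) {z₀ : ℂ} {N n K : ℝ} {k₁ kk : ℕ} (hk : k₁ ≤ kk)
    (hΩ : Metric.closedBall ((δ : ℂ) * z₀) (δ * (N + 1)) ⊆ Ω)
    (h1N : ∀ (H : SimpleGraph HexVertex) (Λ : Finset HexVertex) (w w' : Sym2 HexVertex),
      IsVirgin H Λ z₀ N → Straddles Λ z₀ N w → Straddles Λ z₀ N w' →
      travMass H Λ w w' k₁ z₀ n (N / 2) ≤ K * arcMass H Λ w w') :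
    ∀ (Λ' : Finset HexVertex) (m m' : Sym2 HexVertex),
      (∀ v : HexVertex, dist (hexCenter v) z₀ < N → v ∈ Λ') →
      (∃ u c : HexVertex, m = s(u, c) ∧ hexGraph.Adj u c ∧ u ∉ Λ' ∧ c ∈ Λ' ∧
        c ∈ embMeshDomain hexGraph hexCenter Ω δ ∧ dist (hexCenter c) z₀ ≤ N ∧
        N < dist (hexCenter u) z₀) →
      (∃ u c : HexVertex, m' = s(u, c) ∧ hexGraph.Adj u c ∧ u ∉ Λ' ∧ c ∈ Λ' ∧
        c ∈ embMeshDomain hexGraph hexCenter Ω δ ∧ dist (hexCenter c) z₀ ≤ N ∧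
        N < dist (hexCenter u) z₀) →
      ∑ α : HexMidEdgeSAW Λ' m m', (if α.verts.IsChain (hexDomainGraph Ω δ).Adj ∧
          (⟨polyline α.points⟩ : Curve ℂ).HasTraversals kk z₀ n (N / 2) then
            hexCriticalFugacity ^ α.length else 0) ≤
        K * ∑ α : HexMidEdgeSAW Λ' m m',
          (if α.verts.IsChain (hexDomainGraph Ω δ).Adj then hexCriticalFugacity ^ α.length else 0) := by
  intro Λ' m m' hmem hm hm'
  obtain ⟨u, c, rfl, hadj, hu, hc, hcmesh, hcN, huN⟩ := hm
  have hw' : Straddles Λ' z₀ N m' := by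
    obtain ⟨u', c', rfl, hadj', hu', hc', -, hcN', huN'⟩ := hm'
    exact ⟨u', c', rfl, hadj', hu', hc', hcN', huN'⟩
  have h := h1N _ Λ' _ _ (isVirgin_sup_disc (Ω := Ω) (δ := δ) hmem)
    ⟨u, c, rfl, hadj, hu, hc, hcN, huN⟩ hw'
  simp only [travMass, arcMass] at h
  exact sum_ite_and_le_of_iff_of_imp (P' := fun α => IsHArc _ α) (Q' := fun α => (arcCurve α).HasTraversals k₁ z₀ n (N / 2))
    (fun α : HexMidEdgeSAW Λ' s(u, c) m' => hexCriticalFugacity ^ α.length)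
    (fun α => pow_nonneg hexCriticalFugacity_pos_lt_one.1.le _)
    (fun α => isChain_sup_disc_iff hδ hΩ hu hcmesh α)
    (fun α hα => Curve.HasTraversals.of_le hα hk) h

/-- The radial arc bound (hypothesis 2, applied to the same enlarged graph) yields the rooted arc
inequality over arcs using edges of `Ω_δ` that `sum_vertexTraversals_le_rooted` consumes. -/
theorem arcSums_of_rootedShellBound (hδ : 0 < δ) {z₀ : ℂ} {N n K : ℝ} {k₂ kk : ℕ} (hk : k₂ ≤ kk)
    (hΩ : Metric.closedBall ((δ : ℂ) * z₀) (δ * (N + 1)) ⊆ Ω) {b : HexVertex}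
    (hb : dist (hexCenter b) z₀ ≤ n)
    (h2N : ∀ (H : SimpleGraph HexVertex) (Λ : Finset HexVertex) (w : Sym2 HexVertex)
      (p q : HexVertex), IsVirgin H Λ z₀ N → Straddles Λ z₀ N w → dist (hexCenter p) z₀ ≤ n →
      H.Adj q p → travMass H (Λ.erase p) w s(q, p) k₂ z₀ n (N / 2) ≤
        K * arcMass H (Λ.erase p) w s(q, p)) :
    ∀ (Λ' : Finset HexVertex) (m : Sym2 HexVertex) (q : HexVertex),
      (∀ v : HexVertex, dist (hexCenter v) z₀ < N → v ∈ Λ') →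
      (∃ u c : HexVertex, m = s(u, c) ∧ hexGraph.Adj u c ∧ u ∉ Λ' ∧ c ∈ Λ' ∧
        c ∈ embMeshDomain hexGraph hexCenter Ω δ ∧ dist (hexCenter c) z₀ ≤ N ∧
        N < dist (hexCenter u) z₀) →
      (hexDomainGraph Ω δ).Adj q b →
      ∑ α : HexMidEdgeSAW (Λ'.erase b) m s(q, b), (if α.verts.IsChain (hexDomainGraph Ω δ).Adj ∧
          (⟨polyline α.points⟩ : Curve ℂ).HasTraversals kk z₀ n (N / 2) then
            hexCriticalFugacity ^ α.length else 0) ≤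
        K * ∑ α : HexMidEdgeSAW (Λ'.erase b) m s(q, b),
          (if α.verts.IsChain (hexDomainGraph Ω δ).Adj then hexCriticalFugacity ^ α.length else 0) := by
  intro Λ' m q hmem hm hqb
  obtain ⟨u, c, rfl, hadj, hu, hc, hcmesh, hcN, huN⟩ := hm
  have h := h2N _ Λ' _ b q (isVirgin_sup_disc (Ω := Ω) (δ := δ) hmem)
    ⟨u, c, rfl, hadj, hu, hc, hcN, huN⟩ hb ((SimpleGraph.sup_adj _ _ _ _).2 (Or.inl hqb))
  simp only [travMass, arcMass] at h
  have hu' : u ∉ Λ'.erase b := fun h' => hu (Finset.mem_of_mem_erase h')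
  exact sum_ite_and_le_of_iff_of_imp (P' := fun α => IsHArc _ α) (Q' := fun α => (arcCurve α).HasTraversals k₂ z₀ n (N / 2))
    (fun α : HexMidEdgeSAW (Λ'.erase b) s(u, c) s(q, b) => hexCriticalFugacity ^ α.length)
    (fun α => pow_nonneg hexCriticalFugacity_pos_lt_one.1.le _)
    (fun α => isChain_sup_disc_iff hδ hΩ hu' hcmesh α)
    (fun α hα => Curve.HasTraversals.of_le hα hk) h

end ArcSums

/-! ## The registered stub -/

/-- **stub 5 — VIRGINIZATION** of the crux skeleton `reversal-virgin-disc` (exact identities +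
bookkeeping): the chordal (`ArcShellBound`) and radial (`RootedShellBound`) arc shell bounds imply
Aizenman–Burchard's (H1) on INTERIOR shells for the critical hexagonal SAW law, for every Dobrushin
domain and endpoint approximation. Proof: both bounds at exponent `7`, final exponent `7/3`;
threshold `2(max k₀ + 1)`; thin shells and the both-endpoints-deep case of the cube-root trick
(`exists_subshell`; the endpoint limits separate `a_δ`, `b_δ`) are absorbed into the constant; on
the chosen sub-shell the event is transported to the vertex sequence
(`vertexTraversals_of_hasTraversals_toCurve`) and the two-sided domain Markov reductions
`sum_vertexTraversals_le_chordal` / `…_rooted` (with reversal of the walk when `a_δ` is the deep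
endpoint) are fed with the arc bounds on the graph `Ω_δ` enlarged inside the disc
(`arcSums_of_arcShellBound`, `arcSums_of_rootedShellBound`); the law is the normalised finite sum
`embLaw_apply_le_ofReal`. -/
theorem stub_virginization :
    (∀ lam : ℝ, 0 < lam → ∃ (k₀ : ℕ) (K N₀ : ℝ), 0 ≤ K ∧ 0 < N₀ ∧
      ∀ (H : SimpleGraph HexVertex) (Λ : Finset HexVertex) (z₀ : ℂ) (n N : ℝ)
        (w w' : Sym2 HexVertex), N₀ ≤ n → 4 * n ≤ N →
        IsVirgin H Λ z₀ N → Straddles Λ z₀ N w → Straddles Λ z₀ N w' →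
        travMass H Λ w w' k₀ z₀ n (N / 2) ≤ K * (n / N) ^ lam * arcMass H Λ w w') →
    (∀ lam : ℝ, 0 < lam → ∃ (k₀ : ℕ) (K N₀ : ℝ), 0 ≤ K ∧ 0 < N₀ ∧
      ∀ (H : SimpleGraph HexVertex) (Λ : Finset HexVertex) (z₀ : ℂ) (n N : ℝ)
        (w : Sym2 HexVertex) (p q : HexVertex), N₀ ≤ n → 4 * n ≤ N →
        IsVirgin H Λ z₀ N → Straddles Λ z₀ N w → dist (hexCenter p) z₀ ≤ n → H.Adj q p →
        travMass H (Λ.erase p) w s(q, p) k₀ z₀ n (N / 2) ≤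
          K * (n / N) ^ lam * arcMass H (Λ.erase p) w s(q, p)) →
    ∀ (D : DobrushinDomain) (a b : ℝ → HexVertex),
      IsEmbEndpointApprox hexGraph hexCenter D a b →
      ∃ (k : ℂ → ℝ → ℝ → ℕ) (K lam δ₀ : ℝ), 0 ≤ K ∧ 2 < lam ∧ 0 < δ₀ ∧
        ∀ δ ∈ Set.Ioc 0 δ₀, ∀ (x : ℂ) (ρ R : ℝ), δ ≤ ρ → ρ < R → R ≤ 1 →
          Metric.closedBall x R ⊆ D.carrier →
          hexSAWLaw D.carrier δ (a δ) (b δ)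
            {γ | (⟨γ.walk.toCurve fun v => (δ : ℂ) * hexCenter v⟩ : Curve ℂ).HasTraversals
              (k x ρ R) x ρ R} ≤ ENNReal.ofReal (K * (ρ / R) ^ lam) := by
  intro h1 h2 D a b hab
  obtain ⟨k₁, K₁, N₁, hK₁, hN₁, h1'⟩ := h1 7 (by norm_num)
  obtain ⟨k₂, K₂, N₂, hK₂, hN₂, h2'⟩ := h2 7 (by norm_num)
  -- constants
  obtain ⟨N₀, hN₀⟩ : ∃ N₀ : ℝ, N₀ = max N₁ N₂ := ⟨_, rfl⟩
  have hN₀pos : 0 < N₀ := hN₀ ▸ lt_max_of_lt_left hN₁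
  have hN₁₀ : N₁ ≤ N₀ := hN₀ ▸ le_max_left _ _
  have hN₂₀ : N₂ ≤ N₀ := hN₀ ▸ le_max_right _ _
  have hd : D.pt 0 ≠ D.pt 1 := fun e => absurd (D.pt_injective e) (by decide)
  obtain ⟨d₀, hd₀⟩ : ∃ d₀ : ℝ, d₀ = dist (D.pt 0) (D.pt 1) / 2 := ⟨_, rfl⟩
  have hd₀pos : 0 < d₀ := by rw [hd₀]; exact half_pos (dist_pos.2 hd)
  obtain ⟨M, hM⟩ : ∃ M : ℝ, M = max 8 (2 * N₀) := ⟨_, rfl⟩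
  obtain ⟨Λs, hΛs⟩ : ∃ Λs : ℝ, Λs = max 19 (4 * N₀ + 3) := ⟨_, rfl⟩
  have hΛs0 : 0 ≤ Λs := hΛs ▸ le_trans (by norm_num) (le_max_left _ _)
  obtain ⟨K, hK⟩ : ∃ K : ℝ, K = max (max (Λs ^ 7) ((2 / d₀) ^ 7)) (max K₁ K₂ * M ^ 7) := ⟨_, rfl⟩
  have hKΛ : Λs ^ 7 ≤ K := hK ▸ (le_max_left _ _).trans (le_max_left _ _)
  have hKd : (2 / d₀) ^ 7 ≤ K := hK ▸ (le_max_right _ _).trans (le_max_left _ _)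
  have hKK : max K₁ K₂ * M ^ 7 ≤ K := hK ▸ le_max_right _ _
  have hK0 : 0 ≤ K := (pow_nonneg hΛs0 7).trans hKΛ
  -- the mesh threshold from the endpoint limits
  have hev : ∀ᶠ δ : ℝ in 𝓝[>] 0, dist ((δ : ℂ) * hexCenter (a δ)) (D.pt 0) < d₀ / 2 ∧
      dist ((δ : ℂ) * hexCenter (b δ)) (D.pt 1) < d₀ / 2 :=
    (Metric.tendsto_nhds.1 hab.tendsto_fst _ (half_pos hd₀pos)).and
      (Metric.tendsto_nhds.1 hab.tendsto_snd _ (half_pos hd₀pos))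
  obtain ⟨δ₁, hδ₁, hgood⟩ := mem_nhdsGT_iff_exists_Ioo_subset.1 hev
  have hδ₁pos : 0 < δ₁ := hδ₁
  refine ⟨fun _ _ _ => 2 * (max k₁ k₂ + 1), K, 7 / 3, δ₁ / 2, hK0, by norm_num, by positivity, ?_⟩
  intro δ hδ x ρ R hδρ hρR hR1 hball
  have hδpos : 0 < δ := hδ.1
  have hδ' : (δ : ℂ) ≠ 0 := by exact_mod_cast hδpos.ne'
  obtain ⟨hA0, hB1⟩ := hgood (show δ ∈ Set.Ioo 0 δ₁ from ⟨hδ.1, by linarith [hδ.2]⟩)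
  have hne : a δ ≠ b δ := by
    intro h
    rw [h] at hA0
    linarith [dist_pos.2 hd, dist_triangle (D.pt 0) ((δ : ℂ) * hexCenter (b δ)) (D.pt 1),
      dist_comm (D.pt 0) ((δ : ℂ) * hexCenter (b δ))]
  haveI := finite_hexDomainSAW D.isBounded hδpos.ne' (a δ) (b δ)
  haveI := finite_hexDomainSAW D.isBounded hδpos.ne' (b δ) (a δ)
  haveI := Fintype.ofFinite (HexDomainSAW D.carrier δ (a δ) (b δ))
  haveI := Fintype.ofFinite (HexDomainSAW D.carrier δ (b δ) (a δ))
  have hxc := hexCriticalFugacity_pos_lt_one.1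
  -- trivial bound
  by_cases htriv : 1 ≤ K * (ρ / R) ^ (7 / 3 : ℝ)
  · exact (embLaw_apply_le_one _).trans (ENNReal.one_le_ofReal.2 htriv)
  rw [not_le] at htriv
  -- the aspect parameter `u = (ρ/R)^{1/3}`
  have hρ : 0 < ρ := hδpos.trans_le hδρ
  have hR : 0 < R := hρ.trans hρR
  have hθ0 : 0 < ρ / R := div_pos hρ hR
  have hθ1 : ρ / R ≤ 1 := (div_le_one hR).2 hρR.le
  obtain ⟨hu0, hu1, hu3, hθ73⟩ := rpow_third_facts hθ0 hθ1
  obtain ⟨u, hu⟩ : ∃ u : ℝ, u = (ρ / R) ^ (1 / 3 : ℝ) := ⟨_, rfl⟩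
  rw [← hu] at hu0 hu1 hu3 hθ73
  rw [hθ73] at htriv
  have hRu : R = ρ / u ^ 3 := by rw [hu3]; field_simp
  have hu7 : 0 < u ^ 7 := by positivity
  have hlt1 : ∀ c : ℝ, 0 ≤ c → c ^ 7 ≤ K → c * u < 1 := by
    intro c hc hcK
    by_contra hge
    rw [not_lt] at hge
    have h1 : 1 ≤ (c * u) ^ 7 := one_le_pow₀ hge
    have h2 : (c * u) ^ 7 ≤ K * u ^ 7 := by
      rw [mul_pow]; exact mul_le_mul_of_nonneg_right hcK hu7.le
    linarith
  have hΛsu := hlt1 Λs hΛs0 hKΛ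
  have h19 : 19 ≤ 1 / u := by
    rw [le_div_iff₀ hu0]; nlinarith [hΛs ▸ (le_max_left 19 (4 * N₀ + 3))]
  have hΛ : 4 * N₀ + 3 ≤ 1 / u := by
    rw [le_div_iff₀ hu0]; nlinarith [hΛs ▸ (le_max_right 19 (4 * N₀ + 3))]
  have hud : 2 * u < d₀ := by
    have := hlt1 (2 / d₀) (by positivity) hKd
    rwa [div_mul_eq_mul_div, div_lt_one hd₀pos] at this
  -- the lattice data
  obtain ⟨z₀, hz₀⟩ : ∃ z₀ : ℂ, z₀ = x / δ := ⟨_, rfl⟩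
  have hxz : x = (δ : ℂ) * z₀ := by rw [hz₀]; field_simp
  have hdist : ∀ v : HexVertex, dist ((δ : ℂ) * hexCenter v) x = δ * dist (hexCenter v) z₀ := by
    intro v
    rw [hxz, dist_eq_norm, ← mul_sub, norm_mul, Complex.norm_real, Real.norm_of_nonneg hδpos.le,
      ← dist_eq_norm]
  have hedge : ∀ u v : HexVertex, hexGraph.Adj u v → dist (hexCenter u) (hexCenter v) ≤ 1 :=
    fun u v h => dist_hexCenter_le_one_of_adj h.symm
  -- the sub-shell missing both marked points
  obtain ⟨s, hρs, hsu, hs2, hAs, hBs⟩ := exists_subshell ρ u (dist ((δ : ℂ) * hexCenter (a δ)) x)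
    (dist ((δ : ℂ) * hexCenter (b δ)) x) hρ hu0 hu1
  have hδs : δ ≤ s := hδρ.trans hρs
  have hspos : 0 < s := hδpos.trans_le hδs
  have hSR : s / u ≤ R := by rwa [hRu]
  obtain ⟨N, hNdef⟩ : ∃ N : ℝ, N = s / u / δ - 3 := ⟨_, rfl⟩
  obtain ⟨n, hndef⟩ : ∃ n : ℝ, n = max (s / δ + 3) N₀ := ⟨_, rfl⟩
  obtain ⟨hNpos, hN₀n, h4n, hrR', hrn', hNR', hnN, hnN', h6⟩ :
      0 < N ∧ N₀ ≤ n ∧ 4 * n ≤ N ∧ s / δ + 2 + 1 < N - 1 ∧ s / δ + 2 + 1 ≤ n ∧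
      N / 2 + 1 ≤ N - 1 ∧ n ≤ N ∧ n / N ≤ max 8 (2 * N₀) * u ∧ 6 * δ ≤ s / u := by
    rw [hNdef, hndef]; exact subshell_parameters hδpos hδs hu0 hN₀pos h19 hΛ
  rw [← hM] at hnN'
  have hNδ : δ * (N + 1) = s / u - 2 * δ := by
    rw [hNdef]; field_simp [hδpos.ne', hu0.ne']; ring
  have hΩ' : Metric.closedBall ((δ : ℂ) * z₀) (δ * (N + 1)) ⊆ D.carrier := by
    rw [← hxz, hNδ]
    exact (Metric.closedBall_subset_closedBall (by linarith)).trans hball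
  -- the vertex set: vertices of `Ω_δ` and the cells of the open `N`-disc
  have hfin₁ : (embMeshDomain hexGraph hexCenter D.carrier δ).Finite :=
    (finite_embMeshVertices_hex D.isBounded hδpos.ne').subset (embMeshDomain_subset _ _ _ _)
  have hfin₂ : {v : HexVertex | dist (hexCenter v) z₀ < N}.Finite := by
    refine (finite_embMeshVertices_hex (Metric.isBounded_ball (x := z₀) (r := N))
      one_ne_zero).subset fun v hv => ?_
    have : dist (hexCenter v) z₀ < N := hv
    simpa only [mem_embMeshVertices_iff, Complex.ofReal_one, one_mul, Metric.mem_ball] using this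
  set Λ₀ := hfin₁.toFinset ∪ hfin₂.toFinset with hΛ₀
  have hdisc : ∀ v : HexVertex, dist (hexCenter v) z₀ < N → v ∈ Λ₀ := fun v hv =>
    Finset.mem_union_right _ (hfin₂.mem_toFinset.2 hv)
  have hmeshΛ : ∀ v ∈ embMeshDomain hexGraph hexCenter D.carrier δ, v ∈ Λ₀ := fun v hv =>
    Finset.mem_union_left _ (hfin₁.mem_toFinset.2 hv)
  -- the bound to prove, as an inequality between finite sums
  have hnN0 : 0 ≤ (n / N) ^ (7 : ℝ) := Real.rpow_nonneg (div_nonneg (hN₀pos.le.trans hN₀n) hNpos.le) _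
  have hn_le : (n / N) ^ (7 : ℝ) ≤ M ^ 7 * u ^ 7 := by
    rw [show (7 : ℝ) = ((7 : ℕ) : ℝ) by norm_num, Real.rpow_natCast, ← mul_pow]
    exact pow_le_pow_left₀ (div_nonneg (hN₀pos.le.trans hN₀n) hNpos.le) hnN' 7
  have hCK : max K₁ K₂ * (n / N) ^ (7 : ℝ) ≤ K * (ρ / R) ^ (7 / 3 : ℝ) := by
    rw [hθ73]
    calc max K₁ K₂ * (n / N) ^ (7 : ℝ) ≤ max K₁ K₂ * (M ^ 7 * u ^ 7) :=
          mul_le_mul_of_nonneg_left hn_le (hK₁.trans (le_max_left _ _))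
      _ = max K₁ K₂ * M ^ 7 * u ^ 7 := by ring
      _ ≤ K * u ^ 7 := mul_le_mul_of_nonneg_right hKK hu7.le
  have hC0 : 0 ≤ max K₁ K₂ * (n / N) ^ (7 : ℝ) := mul_nonneg (hK₁.trans (le_max_left _ _)) hnN0
  -- it suffices to dominate the event by a finite set of SAWs of controlled mass
  suffices key : ∃ (S : Finset (HexDomainSAW D.carrier δ (a δ) (b δ))) (C : ℝ),
      ∑ ω ∈ S, hexCriticalFugacity ^ ω.vertexCount ≤
          C * ∑ ω : HexDomainSAW D.carrier δ (a δ) (b δ), hexCriticalFugacity ^ ω.vertexCount ∧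
        C ≤ max K₁ K₂ * (n / N) ^ (7 : ℝ) ∧
        ∀ ω : HexDomainSAW D.carrier δ (a δ) (b δ),
          (⟨ω.walk.toCurve fun v => (δ : ℂ) * hexCenter v⟩ : Curve ℂ).HasTraversals
            (2 * (max k₁ k₂ + 1)) x ρ R → ω ∈ S by
    obtain ⟨S, C, hSC, hC, hS⟩ := key
    have hnn : ∀ ω : HexDomainSAW D.carrier δ (a δ) (b δ), 0 ≤ hexCriticalFugacity ^ ω.vertexCount :=
      fun ω => pow_nonneg hxc.le _
    refine (embLaw_apply_le_ofReal hxc.le hC0 ?_).trans (ENNReal.ofReal_le_ofReal hCK)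
    calc _ ≤ ∑ ω ∈ S, hexCriticalFugacity ^ ω.vertexCount :=
          Finset.sum_le_sum_of_subset_of_nonneg (fun ω hω => hS ω (Finset.mem_filter.1 hω).2)
            fun ω _ _ => hnn ω
      _ ≤ _ := hSC
      _ ≤ _ := mul_le_mul_of_nonneg_right hC (Finset.sum_nonneg fun ω _ => hnn ω)
  -- the event implies the discrete event on the vertex sequence, in lattice units
  have hincl : ∀ ω : HexDomainSAW D.carrier δ (a δ) (b δ),
      (⟨ω.walk.toCurve fun v => (δ : ℂ) * hexCenter v⟩ : Curve ℂ).HasTraversals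
        (2 * (max k₁ k₂ + 1)) x ρ R →
      ∃ ι κ : Fin (2 * (max k₁ k₂ + 1)) → Fin (ω.walk.support.map hexCenter).length,
        (∀ m, ι m ≤ κ m) ∧
        (∀ m, (dist ((ω.walk.support.map hexCenter).get (ι m)) z₀ ≤ s / δ + 2 ∧
            N - 1 ≤ dist ((ω.walk.support.map hexCenter).get (κ m)) z₀) ∨
          (N - 1 ≤ dist ((ω.walk.support.map hexCenter).get (ι m)) z₀ ∧
            dist ((ω.walk.support.map hexCenter).get (κ m)) z₀ ≤ s / δ + 2)) ∧
        ∀ ⦃m m'⦄, m < m' → κ m ≤ ι m' := by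
    intro ω hω
    have h' := vertexTraversals_of_hasTraversals_toCurve ω hδpos hedge
      (hω.mono' hρs (by linarith : s / u - 3 * δ ≤ R))
    rw [← hz₀] at h'
    refine vertexTraversals_mono h' ?_ ?_
    · rw [div_add' _ _ _ hδpos.ne', div_le_div_iff_of_pos_right hδpos]; linarith
    · rw [hNdef, le_div_iff₀ hδpos, sub_mul, sub_mul, div_mul_cancel₀ _ hδpos.ne']; linarith
  have hfar : ∀ v : HexVertex, s / u < dist ((δ : ℂ) * hexCenter v) x →
      N < dist (hexCenter v) z₀ := by
    intro v hv
    rw [hdist] at hv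
    rw [hNdef]
    have : s / u / δ < dist (hexCenter v) z₀ := by rwa [div_lt_iff₀' hδpos]
    linarith
  have hdeep : ∀ v : HexVertex, dist ((δ : ℂ) * hexCenter v) x ≤ s →
      dist (hexCenter v) z₀ ≤ n := by
    intro v hv
    rw [hdist] at hv
    have : dist (hexCenter v) z₀ ≤ s / δ := by rwa [le_div_iff₀' hδpos]
    linarith
  -- the specialised arc bounds
  have h1N : ∀ (H : SimpleGraph HexVertex) (Λ : Finset HexVertex) (w w' : Sym2 HexVertex),
      IsVirgin H Λ z₀ N → Straddles Λ z₀ N w → Straddles Λ z₀ N w' →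
      travMass H Λ w w' k₁ z₀ n (N / 2) ≤ K₁ * (n / N) ^ (7 : ℝ) * arcMass H Λ w w' :=
    fun H Λ w w' hV hw hw' => h1' H Λ z₀ n N w w' (hN₁₀.trans hN₀n) h4n hV hw hw'
  have h2N : ∀ (H : SimpleGraph HexVertex) (Λ : Finset HexVertex) (w : Sym2 HexVertex)
      (p q : HexVertex), IsVirgin H Λ z₀ N → Straddles Λ z₀ N w → dist (hexCenter p) z₀ ≤ n →
      H.Adj q p → travMass H (Λ.erase p) w s(q, p) k₂ z₀ n (N / 2) ≤
        K₂ * (n / N) ^ (7 : ℝ) * arcMass H (Λ.erase p) w s(q, p) :=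
    fun H Λ w p q hV hw hp hqp => h2' H Λ z₀ n N w p q (hN₂₀.trans hN₀n) h4n hV hw hp hqp
  have hC₁ : K₁ * (n / N) ^ (7 : ℝ) ≤ max K₁ K₂ * (n / N) ^ (7 : ℝ) :=
    mul_le_mul_of_nonneg_right (le_max_left _ _) hnN0
  have hC₂ : K₂ * (n / N) ^ (7 : ℝ) ≤ max K₁ K₂ * (n / N) ^ (7 : ℝ) :=
    mul_le_mul_of_nonneg_right (le_max_right _ _) hnN0
  -- the rooted reduction, for either orientation of the walk
  have hrooted := fun {a' b' : HexVertex} [Fintype (HexDomainSAW D.carrier δ a' b')]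
      (hab' : a' ≠ b') (ha' : N < dist (hexCenter a') z₀) (hb' : dist (hexCenter b') z₀ ≤ n) =>
    sum_vertexTraversals_le_rooted Λ₀
      (fun ω v hv => hmeshΛ v (support_subset_embMeshDomain_of_ne ω hab' v hv)) hdisc
      (fun ω v hv => support_subset_embMeshDomain_of_ne ω hab' v hv) hxc.le (mul_nonneg hK₂ hnN0) hrR'
      hrn' hNR' (by linarith) hnN hedge ha' hb'
      (arcSums_of_rootedShellBound hδpos (le_max_right k₁ k₂) hΩ' hb' h2N)
  rcases hAs with hAin | hAout <;> rcases hBs with hBin | hBout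
  · -- both marked points deep: impossible below the aspect threshold
    exfalso
    have h1 : dist ((δ : ℂ) * hexCenter (a δ)) ((δ : ℂ) * hexCenter (b δ)) ≤ 2 * s := by
      linarith [dist_triangle ((δ : ℂ) * hexCenter (a δ)) x ((δ : ℂ) * hexCenter (b δ)),
        dist_comm x ((δ : ℂ) * hexCenter (b δ))]
    have h2 : d₀ < dist ((δ : ℂ) * hexCenter (a δ)) ((δ : ℂ) * hexCenter (b δ)) := by
      linarith [dist_triangle4 (D.pt 0) ((δ : ℂ) * hexCenter (a δ)) ((δ : ℂ) * hexCenter (b δ))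
        (D.pt 1), dist_comm (D.pt 0) ((δ : ℂ) * hexCenter (a δ))]
    have h3 : s ≤ u := by
      refine hs2.trans ?_
      rw [div_le_iff₀ (by positivity)]
      have : ρ / u ^ 3 ≤ 1 := hRu ▸ hR1
      rw [div_le_iff₀ (by positivity), one_mul] at this
      calc ρ ≤ u ^ 3 := this
        _ = u * u ^ 2 := by ring
    linarith
  · -- `a δ` deep, `b δ` far: reverse the walks and use the rooted reduction from `b δ`
    obtain ⟨S, hS, hmem⟩ := exists_reverse_event_le (E := fun L : List HexVertex =>
      ∃ ι κ : Fin (2 * (max k₁ k₂ + 1)) → Fin (L.map hexCenter).length, (∀ m, ι m ≤ κ m) ∧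
        (∀ m, (dist ((L.map hexCenter).get (ι m)) z₀ ≤ s / δ + 2 ∧
            N - 1 ≤ dist ((L.map hexCenter).get (κ m)) z₀) ∨
          (N - 1 ≤ dist ((L.map hexCenter).get (ι m)) z₀ ∧
            dist ((L.map hexCenter).get (κ m)) z₀ ≤ s / δ + 2)) ∧
        ∀ ⦃m m'⦄, m < m' → κ m ≤ ι m') (hrooted hne.symm (hfar _ hBout) (hdeep _ hAin))
    refine ⟨S, _, hS, hC₂, fun ω hω => hmem ω ?_⟩
    rw [List.map_reverse]
    exact vertexTraversals_reverse (hincl ω hω)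
  · -- `a δ` far, `b δ` deep: the rooted reduction
    exact ⟨_, _, hrooted hne (hfar _ hAout) (hdeep _ hBin), hC₂,
      fun ω hω => mem_filter_univ_of_pred (hincl ω hω)⟩
  · -- both far: the chordal reduction
    exact ⟨_, _, sum_vertexTraversals_le_chordal Λ₀
      (fun ω v hv => hmeshΛ v (support_subset_embMeshDomain_of_ne ω hne v hv)) hdisc
      (fun ω v hv => support_subset_embMeshDomain_of_ne ω hne v hv) hxc.le (mul_nonneg hK₁ hnN0) hrR'
      (by linarith) (by linarith) (by linarith) hedge (hfar _ hAout) (hfar _ hBout)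
      (arcSums_of_arcShellBound hδpos (le_max_left k₁ k₂) hΩ' h1N), hC₁,
      fun ω hω => mem_filter_univ_of_pred (hincl ω hω)⟩

end Summit.CriticalPhenomena.SAWScalingLimit.Theorems.HexTight.Reversal

end
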